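import Mathlib
import Summits.NavierStokesRegularity.NavierStokesRegularity.Theorems.EulerZoomLiouvillePowerGaugeEulerLiouvilleSelfSimilarSubstretchingTools
import HarnessLib.Audit

/-!
# Rung C1 of the crux `EulerZoomLiouville.PowerGaugeEulerLiouville`: countable stagnation points PLUS
# sub-stretching continua — the common generalisation of the stretching and the countability exclusions

Route №10 `EulerZoomLiouville` (NavierStokesRegularity), crux E = stmt-NavierStokesRegularity-19832,
tenure rung C1 (exactly self-similar members), registered residue `stub_selfSimilarExtremal`.
Eleventh file of the NODAL-FINITENESS chain (lineage ns-typeII-p2, gen 6); tools in `…SelfSimilarSubstretchingTools`.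

The two classical-profile exclusions of the lineage have complementary hypotheses on the stagnation set
`𝒩` of `V = γ(y−c) + U` (`0 < γ < ½`, far field (3.8)):
g5 (`IsSelfSimilarEulerProfile.eq_zero_of_stagnation_stretching_lt_one`): `⟪DU(z)w,w⟫ < |w|²` at EVERY
node (any cardinality); g6 (`eq_zero_of_countable_nodalSet`): `𝒩` COUNTABLE (any stretching).  This file
proves the common generalisation: **if `𝒩 ⊆ N₀ ∪ N₁` with `N₀` countable and `N₁` a closed set of
nodes at which the strain is sub-stretching (`⟪DU(z)w,w⟫ < |w|²` for `w ≠ 0`), then `U ≡ 0`** —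
continua of stagnation points (curves, rings, surfaces) are allowed provided the stretching rate stays
below `1` on them; the remaining nodes may be arbitrary but countably many.

* `curl_comp_eq_zero_of_eventually_stretching_le` — KILL along a backward trajectory that eventually
  stays where `⟪DU w,w⟫ ≤ θ₁|w|²`, `θ₁ < 1` (no convergence to a node needed; certificate = the inner
  product; abstract lemma `Literature.Analysis.ODE.eq_zero_of_norm_le_exp_of_lower_certificate`).
* `tendsto_of_transport_comp_tendsto_zero_of_sphereFree` — a bounded curve with `V(Y) → 0` converges to
  its cluster point `z` as soon as arbitrarily small spheres about `z` carry no zero of `V`.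
* `tendsto_or_infDist_tendsto_zero` — dichotomy for a backward trajectory: it converges to a node of
  `N₀` away from `N₁`, or its distance to `N₁` tends to `0`.
* `exists_stretching_le_near` — compactness: sub-stretching on the compact `N₁` gives `θ₁ < 1` and `δ > 0`
  with `⟪DU(y)w,w⟫ ≤ θ₁|w|²` whenever `infDist(y, N₁) < δ`.
* `curl_eq_zero_of_countable_union_substretching`, **`eq_zero_of_countable_union_substretching`** — the
  theorem; `eq_zero_of_stagnation_stretching_lt_one'` re-derives g5's exclusion as the case `N₀ = ∅`
  (the case `N₁ = ∅` is the landed `eq_zero_of_countable_nodalSet`).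

WHAT THIS IS NOT: not NS, not E, not rung C1 — classical (`C²`) profiles with the far field (3.8);
continua of stagnation points carrying stretching `≥ 1` somewhere, and the weak class, are untouched.

## References

* P. Constantin, M. Ignatova, V. Vicol, arXiv:2602.17570 (2026), §3.5 Thms 3.8–3.10, §4 (stagnation
  rings of axisymmetric profiles). [ConstantinIgnatovaVicol2026Putative]
-/

noncomputable section

-- flat `Theorems/<Route><Decl>…` files of one crux share the namespace of the crux (tree convention)
set_option linter.dupNamespace false

open Set Filter Topology Metric Function InnerProductSpace
open scoped RealInnerProductSpace NNReal

namespace Summit.NavierStokesRegularity.NavierStokesRegularity.Theorems.PowerGaugeEulerLiouville.NodalFiniteness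

open Literature.Analysis Literature.Analysis.FluidPDE Literature.Analysis.ODE

variable {γ C : ℝ} {c : EuclideanSpace ℝ (Fin 3)}
  {U : EuclideanSpace ℝ (Fin 3) → EuclideanSpace ℝ (Fin 3)} {P : EuclideanSpace ℝ (Fin 3) → ℝ}

/-! ### The common generalisation -/

/-- **Countable nodes plus sub-stretching continua, vorticity form.**  Let `0 < γ < ½`, `(U, P)` a `C²`
self-similar Euler profile (CIV (3.3)) with (3.8), and suppose the nodal set of `V = γ(y−c) + U` is
contained in `N₀ ∪ N₁` with `N₀` countable and `N₁` a closed set at whose points the strain is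
sub-stretching, `⟪DU(z)w,w⟫ < |w|²` (`w ≠ 0`).  Then `curl U = 0`: a backward trajectory either
approaches `N₁` (uniform KILL, `curl_comp_eq_zero_of_eventually_stretching_le`) or converges to a
node of `N₀` (certified, `certificate_of_mem_nodalSet`); Baire over `N₀`.
[cite: ConstantinIgnatovaVicol2026Putative, §3.5 Thm 3.10 (countable ∪ sub-stretching nodal set; not in print)] -/
theorem curl_eq_zero_of_countable_union_substretching (h : IsSelfSimilarEulerProfile γ c U P)
    (hγ : 0 < γ) (hγ2 : γ < 1 / 2) (hfar : HasSelfSimilarFarFieldWith γ c C U)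
    {N₀ N₁ : Set (EuclideanSpace ℝ (Fin 3))} (hN₀ : N₀.Countable) (hN₁ : IsClosed N₁)
    (hcover : selfSimilarNodalSet γ c U ⊆ N₀ ∪ N₁)
    (hsub : ∀ z ∈ N₁, ∀ w : EuclideanSpace ℝ (Fin 3), w ≠ 0 → ⟪fderiv ℝ U z w, w⟫ < ‖w‖ ^ 2) :
    curl U = 0 := by
  classical
  -- the case `N₁ ∩ 𝒩 = ∅` up to emptiness of `N₁`: if `N₁ = ∅` the nodal set is countable
  rcases N₁.eq_empty_or_nonempty with hN₁e | hN₁ne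
  · have hN : (selfSimilarNodalSet γ c U).Countable :=
      hN₀.mono fun z hz => by simpa [hN₁e] using hcover hz
    exact curl_eq_zero_of_countable_nodalSet_of_certificates h hγ hγ2 hfar hN
      fun _ hz => certificate_of_mem_nodalSet h hγ hγ2 hz
  set V := selfSimilarTransport γ c U with hV
  set N := selfSimilarNodalSet γ c U with hNdef
  have hγ' : γ ≠ 1 / 2 := hγ2.ne
  have hK := lipschitzWith_transport h hγ hfar
  have hU2 := h.contDiff_velocity
  -- uniform sub-stretching near the compact `N₁ ∩ closedBall` — we use the compact `N₁ ∩ 𝒩̄`-free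
  -- version: replace `N₁` by the compact `N₁' = N₁ ∩ closedBall c R₀` containing `N₁ ∩ 𝒩`.
  obtain ⟨R₀, hR₀, hNball⟩ : ∃ R₀ : ℝ, 0 < R₀ ∧ N ⊆ closedBall c R₀ := by
    obtain ⟨R, hR, hsub'⟩ := hfar.selfSimilarNodalSet_subset_closedBall hγ
    exact ⟨R, hR, hsub'⟩
  set N₁' : Set (EuclideanSpace ℝ (Fin 3)) := N₁ ∩ closedBall c R₀ with hN₁'
  have hN₁'c : IsCompact N₁' := (isCompact_closedBall c R₀).inter_left hN₁
  have hcover' : ∀ y, V y = 0 → y ∈ N₀ ∪ N₁' := by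
    intro y hy
    have hyN : y ∈ N := by
      rw [hNdef, mem_selfSimilarNodalSet_iff]; exact hy
    rcases hcover hyN with h0 | h1
    · exact Or.inl h0
    · exact Or.inr ⟨h1, hNball hyN⟩
  -- if `N₁'` is empty we are again in the countable case
  rcases N₁'.eq_empty_or_nonempty with hN₁'e | hN₁'ne
  · have hN : (selfSimilarNodalSet γ c U).Countable := hN₀.mono fun z hz => by
      have := hcover' z (mem_selfSimilarNodalSet_iff.1 hz)
      simpa [hN₁'e] using this
    exact curl_eq_zero_of_countable_nodalSet_of_certificates h hγ hγ2 hfar hN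
      fun _ hz => certificate_of_mem_nodalSet h hγ hγ2 hz
  obtain ⟨θ₁, hθ₁, δ₁, hδ₁, hnear⟩ :=
    exists_stretching_le_near hU2 hN₁'c hN₁'ne fun z hz w hw => hsub z hz.1 w hw
  -- THIN data at non-KILL nodes
  set Kill : EuclideanSpace ℝ (Fin 3) → Prop := fun z =>
    ∃ (B : EuclideanSpace ℝ (Fin 3) →L[ℝ] EuclideanSpace ℝ (Fin 3) →L[ℝ] ℝ) (cB β' : ℝ),
      0 < cB ∧ β' < 1 + γ ∧ (∀ v, cB * ‖v‖ ^ 2 ≤ B v v) ∧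
      ∀ v, B (fderiv ℝ V z v) v + B v (fderiv ℝ V z v) ≤ 2 * β' * B v v with hKill
  have hthin : ∀ z, z ∈ N → ¬ Kill z → ∃ δ : ℝ, 0 < δ ∧
      interior {x : EuclideanSpace ℝ (Fin 3) |
        ∀ t, 0 ≤ t → lipschitzFlow hK x (-t) ∈ closedBall z δ} = ∅ := by
    intro z hz hk
    rcases certificate_of_mem_nodalSet h hγ hγ2 hz with hk' | ⟨Q, η, θ, e, hη, hθ, he, hc⟩
    · exact absurd hk' hk
    · obtain ⟨δ, hδ, hint⟩ := interior_backwardTrapped_eq_empty h hK z Q hη hθ hc he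
      exact ⟨δ, hδ, hint⟩
  choose! δ hδpos hδint using hthin
  haveI : Countable N₀ := hN₀.to_subtype
  set Z : Set (EuclideanSpace ℝ (Fin 3)) := {x | curl U x = 0} with hZ
  set S : Option (N₀ × ℕ) → Set (EuclideanSpace ℝ (Fin 3)) := fun i =>
    i.elim Z fun p => if (p.1 : EuclideanSpace ℝ (Fin 3)) ∈ N ∧ ¬ Kill (p.1 : EuclideanSpace ℝ (Fin 3))
      then {x | ∀ t, (p.2 : ℝ) ≤ t →
        lipschitzFlow hK x (-t) ∈ closedBall (p.1 : EuclideanSpace ℝ (Fin 3)) (δ p.1)}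
      else ∅ with hS
  have hcurlc : Continuous (curl U) := h.isSelfSimilarEulerVorticityProfile.differentiable_curl.continuous
  have hZc : IsClosed Z := isClosed_eq hcurlc continuous_const
  have hSc : ∀ i, IsClosed (S i) := by
    rintro (_ | ⟨z, n⟩)
    · exact hZc
    · simp only [hS, Option.elim]
      split_ifs
      · exact isClosed_backwardTrapped h hK _ _ _
      · exact isClosed_empty
  have hSint : ∀ p : N₀ × ℕ, interior (S (some p)) = ∅ := by
    rintro ⟨z, n⟩
    simp only [hS, Option.elim]
    split_ifs with hk
    · exact interior_backwardTrapped_from_eq_empty h hK _ _ (hδint z hk.1 hk.2) _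
    · exact interior_empty
  -- continuity of `V` and of backward orbits
  have hVc : Continuous V := by
    have e : V = fun y => γ • (y - c) + U y := rfl
    rw [e]; exact ((continuous_id.sub continuous_const).const_smul γ).add hU2.continuous
  have hcoverS : ⋃ i, S i = univ := by
    rw [eq_univ_iff_forall]
    intro x
    rw [mem_iUnion]
    by_cases hx : curl U x = 0
    · exact ⟨none, hx⟩
    have hY := hasDerivAt_backwardFlow hK x
    obtain ⟨B, hB⟩ := backward_orbit_bounded hγ hfar hY
    have hV0 := h.tendsto_transport_comp_of_bounded hγ' (by norm_num : (-1 : ℝ) ≠ 0) hY hB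
    have hYc : Continuous fun t => lipschitzFlow hK x (-t) :=
      continuous_iff_continuousAt.2 fun t => (hY t).continuousAt
    rcases tendsto_or_infDist_tendsto_zero hVc hN₀ hcover' hYc hB hV0 with hdist | ⟨z, hVz, hzN₁, hz⟩
    · -- the trajectory approaches `N₁'`: uniform KILL
      have hev : ∀ᶠ t in atTop, ∀ w, ⟪fderiv ℝ U (lipschitzFlow hK x (-t)) w, w⟫ ≤ θ₁ * ‖w‖ ^ 2 := by
        have := (Metric.tendsto_nhds.1 hdist) δ₁ hδ₁
        filter_upwards [this] with t ht
        have ht' : infDist (lipschitzFlow hK x (-t)) N₁' < δ₁ := by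
          rw [Real.dist_eq, sub_zero, abs_of_nonneg infDist_nonneg] at ht; exact ht
        exact hnear _ ht'
      have h0 := curl_comp_eq_zero_of_eventually_stretching_le h (norm_curl_le_of_farField hγ hfar)
        (norm_fderiv_le_of_farField hγ hfar) hY hθ₁ hev
      simp only [neg_zero, lipschitzFlow_zero] at h0
      exact absurd h0 hx
    · -- the trajectory converges to a node `z ∈ N₀`
      have hzN : z ∈ N := by
        rw [hNdef, mem_selfSimilarNodalSet_iff]; exact hVz
      have hzN₀ : z ∈ N₀ := (hcover' z hVz).resolve_right hzN₁
      by_cases hk : Kill z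
      · obtain ⟨Bf, cB, β', hcB, hβ', hBf, hc⟩ := hk
        have h0 := curl_comp_eq_zero_of_tendsto_of_lowerCertificate h
          (norm_curl_le_of_farField hγ hfar) (norm_fderiv_le_of_farField hγ hfar) hY hz Bf hcB hBf hβ' hc
        simp only [neg_zero, lipschitzFlow_zero] at h0
        exact absurd h0 hx
      · have hδz := hδpos z hzN hk
        have hev : ∀ᶠ t in atTop, dist (lipschitzFlow hK x (-t)) z < δ z :=
          Metric.tendsto_nhds.1 hz _ hδz
        obtain ⟨T₀, hT₀⟩ := hev.exists_forall_of_atTop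
        obtain ⟨n, hn⟩ := exists_nat_ge T₀
        refine ⟨some (⟨z, hzN₀⟩, n), ?_⟩
        simp only [hS, Option.elim, if_pos (And.intro hzN hk)]
        intro t ht
        exact mem_closedBall.2 (hT₀ t (hn.trans ht)).le
  have hdense := dense_iUnion_interior_of_closed hSc hcoverS
  have hsubZ : (⋃ i, interior (S i)) ⊆ interior Z := by
    intro x hx
    rw [mem_iUnion] at hx
    obtain ⟨i, hi⟩ := hx
    rcases i with _ | p
    · exact hi
    · rw [hSint p] at hi; exact hi.elim
  have hZd : Dense (interior Z) := hdense.mono hsubZ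
  have hZuniv : Z = univ := by
    apply eq_univ_of_univ_subset
    rw [← hZd.closure_eq]
    exact (closure_mono interior_subset).trans hZc.closure_subset
  funext x
  have : x ∈ Z := hZuniv ▸ mem_univ x
  exact this

/-- **COUNTABLE NODES PLUS SUB-STRETCHING CONTINUA ⇒ TRIVIAL (unconditional).**  Let `0 < γ < ½` and
let `(U, P)` be a `C²` self-similar Euler profile (CIV (3.3)) with the far-field bounds (3.8).  If the
stagnation set of `V = γ(y−c) + U` is contained in `N₀ ∪ N₁` with `N₀` countable and `N₁` closed and
sub-stretching (`⟪DU(z)w,w⟫ < |w|²` for `z ∈ N₁`, `w ≠ 0`), then `U ≡ 0`.  Contains the lineage's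
stretching exclusion (`N₀ = ∅`) and the countability exclusion (`N₁ = ∅`); new content: stagnation
CONTINUA (rings, arcs, surfaces) are excluded as soon as the strain is sub-stretching along them,
whatever happens at countably many further nodes.
[cite: ConstantinIgnatovaVicol2026Putative, §3.5 Thm 3.10 (countable ∪ sub-stretching nodal set; not in print)] -/
theorem eq_zero_of_countable_union_substretching (h : IsSelfSimilarEulerProfile γ c U P)
    (hγ : 0 < γ) (hγ2 : γ < 1 / 2) (hfar : HasSelfSimilarFarFieldWith γ c C U)
    {N₀ N₁ : Set (EuclideanSpace ℝ (Fin 3))} (hN₀ : N₀.Countable) (hN₁ : IsClosed N₁)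
    (hcover : selfSimilarNodalSet γ c U ⊆ N₀ ∪ N₁)
    (hsub : ∀ z ∈ N₁, ∀ w : EuclideanSpace ℝ (Fin 3), w ≠ 0 → ⟪fderiv ℝ U z w, w⟫ < ‖w‖ ^ 2) :
    U = 0 := by
  have hcurl0 := curl_eq_zero_of_countable_union_substretching h hγ hγ2 hfar hN₀ hN₁ hcover hsub
  have hcurl : ∀ x, curl U x = 0 := fun x => congrFun hcurl0 x
  have hD := hfar.tendsto_norm_fderiv hγ
  funext y
  rw [eq_of_curl_eq_zero_of_isDivFree_of_fderiv_tendsto_zero h.contDiff_velocity hcurl h.divFree hD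
    y c, hfar.apply_center]
  rfl

/-- **The stretching exclusion re-derived** (`N₀ = ∅`, `N₁` = the whole nodal set; the lineage's
`IsSelfSimilarEulerProfile.eq_zero_of_stagnation_stretching_lt_one`, g5).
[cite: ConstantinIgnatovaVicol2026Putative, §3.5 Thm 3.10 (proof, sharpened)] -/
theorem eq_zero_of_stagnation_stretching_lt_one' (h : IsSelfSimilarEulerProfile γ c U P)
    (hγ : 0 < γ) (hγ2 : γ < 1 / 2) (hfar : HasSelfSimilarFarFieldWith γ c C U)
    (hnode : ∀ z ∈ selfSimilarNodalSet γ c U, ∀ w : EuclideanSpace ℝ (Fin 3), w ≠ 0 →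
      ⟪fderiv ℝ U z w, w⟫ < ‖w‖ ^ 2) : U = 0 := by
  have hVc : Continuous (selfSimilarTransport γ c U) := by
    have e : selfSimilarTransport γ c U = fun y => γ • (y - c) + U y := rfl
    rw [e]
    exact ((continuous_id.sub continuous_const).const_smul γ).add h.contDiff_velocity.continuous
  have hNc : IsClosed (selfSimilarNodalSet γ c U) := by
    have e : selfSimilarNodalSet γ c U = (selfSimilarTransport γ c U) ⁻¹' {0} := by
      ext y; rw [mem_preimage, mem_singleton_iff, mem_selfSimilarNodalSet_iff, selfSimilarTransport_apply]
    rw [e]; exact isClosed_singleton.preimage hVc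
  exact eq_zero_of_countable_union_substretching h hγ hγ2 hfar countable_empty hNc
    (fun _ hz => Or.inr hz) hnode

end Summit.NavierStokesRegularity.NavierStokesRegularity.Theorems.PowerGaugeEulerLiouville.NodalFiniteness
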